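import Literature.IUT.HodgeTheaters.Cor53iFcircBijectiveAtOpenEmbedding
import Literature.IUT.HodgeTheaters.GlobalFrobenioidsFcircRecordBaseOnEquivalences
import Literature.AlgebraicGeometry.Frobenioids.ModelFrobenioidFiberProductPullback
import Literature.AlgebraicGeometry.Frobenioids.ArithmeticDivisorDataRingIsoTransport
import Literature.AnabelianGeometry.SemiGraphs.CosetCategoriesEquivalencePull
import HarnessLib

/-!
# [IUTchI] Cor 5.3 (i) «respectively ⊚»: `hlift⊚` and «bijective» at EVERY OPEN-EMBEDDING push carrier `ℬ(H)⁰ → ℬ(G_F)⁰`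
# modulo Neukirch–Uchida BY NAME — SIDE-FREE (no `Normal ℚ F`, no descent law `hdesc⊚`)

S. Mochizuki, *Inter-universal Teichmüller theory I*, kurims manuscript (May 2020), §5 Cor 5.3 (i) p. 144 l. 2–11 («the natural map
`Isom(¹ℱ^⊚, ²ℱ^⊚) → Isom(Base(¹ℱ^⊚), Base(²ℱ^⊚))` … is bijective»), proof l. 24–33; Example 5.1 (i) p. 123 l. 33–38 (`π₁(†𝒟^⊚)` «as an
open subgroup» — the push-forward along an open INJECTION), (iii) pp. 125–126 (`†ℱ^⊚ := †ℱ^⊛|_{†𝒟^⊚}`), (v) pp. 127–128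
([IUTchI] Cor 5.3 (i) p.144) [claim: Mochizuki2012, status: disputed] (D-0012 claim key; PROOFS ONLY over landed files; nothing of the
series is asserted; no side taken on [IUTchIII] Cor. 3.12).  CLASSICAL inputs (OURS): [FrdI] §0 p. 17 (categorical fibre products,
equivalence over the base), Ex. 6.3 p. 113 (arithmetic divisor data, functorial in the fields) [cite: MochizukiFrdI2008, Ex. 6.3 p.113];
[FrdII] Ex. 1.3 (ii)–(iii) pp. 11–12 (`φ_*`, `φ^*`, the Galois correspondence) [cite: MochizukiFrdII2008, Ex 1.3 (iii) pp.11-12];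
[SemiAnbd] Prop 3.2 p. 35 [cite: MochizukiSemiAnbd2006, Prop 3.2 p.35]; [NSW] Thm (12.2.1) = the tree's NAMED FACT `NeukirchUchida F`,
consumed BY NAME as a hypothesis (bookkeeping, not a proof) [cite: NeukirchSchmidtWingberg2008, Thm (12.2.1)].

PROOF-ONLY (cell abc-iut, seat abc-iut-L5-t11 gen 22, row «LIFT⊚@OPEN-EMBEDDING SIDE-FREE»; 0 def · 0 instance · 0 notation · no Prop
fact).  abc-iut-L5-t4's ★ `Cor53iFcircBijectiveAtOpenEmbedding` proved «bijective» at every open-embedding carrier `ι : H ↪ G_F` modulo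
FACT {`NeukirchUchida F`} · SIDE {`Normal ℚ F`}, the side entering through the DESCENT route (`hdesc⊚ ⟺ AutCompatible ι`, which FAILS
without normality: ★ `Cor53iFcircHdescIffAutCompatible`, ★ `Cor53iFcircHdescNotAtNormalClosureCarrier`).  THIS FILE removes the side
hypothesis by lifting DIRECTLY (the (k2) binder `hlift` of ★ `Cor53TelescopeCensusKnit` l.151–152, stated verbatim):
* §0 `CatIsomorphism.exists_lift_of_equivalence_over` — lifts transport along an equivalence over the base;
* §1 (coset level) for `ι : H → G_F` open, `ψ : H ↠ H`, `τ ∈ Aut(F̄)` with `ι(h) ∘ τ = τ ∘ ι(ψ h)`: `F̄^{ι(ψ⁻¹U)} = τ(F̄^{ι U})`, the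
  ring isomorphisms `a ↦ τ a`, and their naturality for the arrows of `push ι ⋙ (V ↦ Spec F̄^V)` against `ψ^*`;
* §2 `exists_ringEquiv_family_of_push_twist` — the natural family along any twist `ξ : Θ ⋙ Φ ≅ Φ ⋙ ψ^*` read through `Φ : D ⥤ CosetCat H`
  (twin of abc-iut-w4-d109's `QuasiTemperoid.exists_ringEquiv_family_of_twist`, for a twist NOT induced by an endomorphism of `G_F`),
  and `exists_ringEquiv_family_of_iso` — transport along `S ≅ S′`;
* §3 **`GlobalFrobenioid.liftsAll_fcircBase_arith_of_openEmbedding_of_neukirchUchida (hNU) (H) (ι) (hc) (ho) (hinj) (𝓕)`** — the (k2)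
  binder `hlift⊚` VERBATIM at the push carrier of every open embedding, every record: LAW ∅ · FACT {`NeukirchUchida F`} · SIDE ∅;
* §4 KNIT **`Cor53.fcirc_descendBijective_of_openEmbedding_of_neukirchUchida_sideFree`** = t4's headline with `[Normal ℚ F]` DELETED
  (injectivity ★ `Cor53.fcirc_rigidOverBase_of_pushCarrier`, `hZ` from the slimness of `G_F`).

WHY NO NORMALITY IS NEEDED.  `τ` from Neukirch–Uchida at `U₁ = U₂ = ι(H)` normalises `ι(H) = G_K` (`K := F̄^{ι(H)} ⊇ F`), not
necessarily `G_F`; but `†ℱ^⊚ ≌` the model Frobenioid of the WHISKERED data `(Φ^⊛ ∘ T, 𝔹^⊛ ∘ T, Div ∘ T)` over `ℬ(H)⁰`, which only sees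
the fields `F̄^{ι(U)}`, `U ⊆ H` open, and the arrows `a ↦ ι(h) a` — on these `τ` acts (`F̄^{ι(φU)} = τ F̄^{ι U}`, `ι(φ h)(τ a) = τ(ι(h) a)`),
and [FrdI] Ex 6.3 is functorial in ARBITRARY ring isomorphisms of the fields.  E.g. `F = ℚ(∛2)`, `H = G_K`, `K = F(ω)`, `φ` = conjugation
by a lift of the 3-cycle: `hdesc⊚` fails, yet `Θ_φ` lifts.  HONEST TAGS: OUR stand-in carrier (print's `ι` is `π₁(C_K) ↪ π₁(C_{F_mod})`
with `F`-coricity) and OUR lift route (print's surjectivity is functorial reconstruction, Ex 5.1 (v)); typed ≠ inhabited ≠ proved;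
nothing here asserts abc proved or refuted.
-/

noncomputable section

-- `(arith F).Φ = (galoisSubextOfFinite F).op ⋙ arithDivisorFunctor …` and the whiskered data agree only at default
-- transparency (as in ★ `Cor53iFcircHkerTransport`).
set_option backward.isDefEq.respectTransparency false

namespace Literature.IUT.HodgeTheaters

open CategoryTheory Opposite Function
open Literature.AlgebraicGeometry.Frobenioids Literature.AnabelianGeometry.SemiGraphs
open Literature.AlgebraicGeometry.Frobenioids.QuasiTemperoid Literature.NumberTheory.GaloisRepresentations

/-! ### §0. Lifts transport along an equivalence of total categories lying over the base -/

namespace CatIsomorphism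

universe v₁ v₂ v₃ u₁ u₂ u₃

variable {C : Type u₁} [Category.{v₁} C] {C' : Type u₂} [Category.{v₂} C'] {B : Type u₃} [Category.{v₃} B]

/-- **Lifts transport along equivalences OVER the base**: if `e : C′ ⥲ C` lies over `B` (`e ⋙ p ≅ p′`) and `Θ : B ⥲ B` lifts to a
self-equivalence of `C` lying over it, then `Θ` lifts to `C′` — conjugate the lift by `e` ([FrdI] §0: structure functors are taken up
to equivalence over the base; twin of ★ `rigidOverBase_of_equivalence_over`).
([IUTchI] Cor 5.3 (i) p.144) [cite: MochizukiFrdI2008, §0 p.17] [claim: Mochizuki2012, status: disputed] -/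
theorem exists_lift_of_equivalence_over {p : C ⥤ B} {p' : C' ⥤ B} (e : C' ≌ C) (i : e.functor ⋙ p ≅ p') {Θ : B ≌ B}
    (h : ∃ Ψ : C ≌ C, Nonempty (LiesUnder p p Ψ Θ)) : ∃ Ψ' : C' ≌ C', Nonempty (LiesUnder p' p' Ψ' Θ) := by
  obtain ⟨Ψ, ⟨m⟩⟩ := h
  -- `e⁻¹ ⋙ p′ ≅ p`
  have i' : e.inverse ⋙ p' ≅ p :=
    Functor.isoWhiskerLeft e.inverse i.symm ≪≫ (Functor.associator _ _ _).symm ≪≫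
      Functor.isoWhiskerRight e.counitIso p ≪≫ p.leftUnitor
  -- `(e ⋙ Ψ ⋙ e⁻¹) ⋙ p′ ≅ e ⋙ Ψ ⋙ p ≅ e ⋙ p ⋙ Θ ≅ p′ ⋙ Θ`
  exact ⟨e.trans (Ψ.trans e.symm), ⟨Functor.associator e.functor (Ψ.functor ⋙ e.inverse) p' ≪≫
    Functor.isoWhiskerLeft e.functor (Functor.associator Ψ.functor e.inverse p' ≪≫
      Functor.isoWhiskerLeft Ψ.functor i' ≪≫ m) ≪≫
    (Functor.associator e.functor p Θ.functor).symm ≪≫ Functor.isoWhiskerRight i Θ.functor⟩⟩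

end CatIsomorphism

/-! ### §1. At the coset level: `τ` inducing `φ` through `ι` carries `F̄^{ι(U)}` onto `F̄^{ι(φ U)}`, naturally for the push carrier -/

namespace PushCarrier

section Twist

variable {F : Type} [Field F] [PerfectField F]
  {H : Type} [Group H] [TopologicalSpace H] (ι : H →* GalFbar F) (ho : IsOpenMap ι)
  (ψ : H →* H) (hψc : Continuous ψ) (hψs : Surjective ψ)
  (τ : Fbar F ≃+* Fbar F) (hτ : ∀ (h : H) (x : Fbar F), ι h (τ x) = τ (ι (ψ h) x))

include hτ hψs in
/-- **The field over `ψ⁻¹(U)` is `τ` of the field over `U`**: for `τ` inducing `ψ` through `ι` (`ι(h) ∘ τ = τ ∘ ι(ψ h)`) and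
`U ⊆ H` open, `y ∈ F̄^{ι(ψ⁻¹ U)} ↔ τ⁻¹ y ∈ F̄^{ι(U)}` (`ψ` surjective). For `ψ = φ⁻¹` this reads `F̄^{ι(φ U)} = τ(F̄^{ι U})`.
([IUTchI] Ex 5.1 (i) p.123) [cite: MochizukiFrdII2008, Ex 1.3 (iii) pp.11-12] [claim: Mochizuki2012, status: disputed] -/
theorem mem_fixedField_push_pull_iff (U : CosetCat H) (y : Fbar F) :
    y ∈ ((CosetCat.push ι ho ⋙ cosetFixedSubext F).obj ((CosetCat.pull ψ hψc hψs).obj U)).L ↔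
      τ.symm y ∈ ((CosetCat.push ι ho ⋙ cosetFixedSubext F).obj U).L := by
  change y ∈ IntermediateField.fixedField
      ((CosetCat.mapOpen ι ho ((CosetCat.pull ψ hψc hψs).obj U).sg : OpenSubgroup (GalFbar F)) : Subgroup (GalFbar F)) ↔
    τ.symm y ∈ IntermediateField.fixedField ((CosetCat.mapOpen ι ho U.sg : OpenSubgroup (GalFbar F)) : Subgroup (GalFbar F))
  rw [IntermediateField.mem_fixedField_iff, IntermediateField.mem_fixedField_iff]
  constructor
  · intro hy w hw
    obtain ⟨u, hu, rfl⟩ := (CosetCat.mem_mapOpen ι ho).mp hw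
    obtain ⟨h, rfl⟩ := hψs u
    have hh : h ∈ U.sg.comap ψ hψc := OpenSubgroup.mem_comap.mpr hu
    have h1 : ι h y = y := hy (ι h) ((CosetCat.mem_mapOpen ι ho).mpr ⟨h, hh, rfl⟩)
    apply τ.injective
    rw [← hτ h (τ.symm y), τ.apply_symm_apply, h1]
  · intro hy w hw
    obtain ⟨h, hh, rfl⟩ := (CosetCat.mem_mapOpen ι ho).mp hw
    have hu : ψ h ∈ U.sg := (OpenSubgroup.mem_comap : h ∈ U.sg.comap ψ hψc ↔ _).mp hh
    change ι h y = y
    conv_lhs => rw [← τ.apply_symm_apply y]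
    rw [hτ h (τ.symm y), hy (ι (ψ h)) ((CosetCat.mem_mapOpen ι ho).mpr ⟨ψ h, hu, rfl⟩), τ.apply_symm_apply]

include hτ hψs in
/-- Forward form: `a ∈ F̄^{ι(U)} → τ a ∈ F̄^{ι(ψ⁻¹ U)}`. ([IUTchI] Ex 5.1 (i) p.123) [claim: Mochizuki2012, status: disputed] -/
theorem apply_mem_fixedField_push_pull (U : CosetCat H) {a : Fbar F}
    (ha : a ∈ ((CosetCat.push ι ho ⋙ cosetFixedSubext F).obj U).L) :
    τ a ∈ ((CosetCat.push ι ho ⋙ cosetFixedSubext F).obj ((CosetCat.pull ψ hψc hψs).obj U)).L := by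
  rw [mem_fixedField_push_pull_iff ι ho ψ hψc hψs τ hτ, τ.symm_apply_apply]
  exact ha

include hτ hψs in
/-- **The ring isomorphisms `e_U : F̄^{ι(U)} ≃+* F̄^{ι(ψ⁻¹ U)}`, `a ↦ τ a`** (NOT `F`-linear: `τ` may move `F`).
([IUTchI] Ex 5.1 (i) p.123) [cite: MochizukiFrdII2008, Ex 1.3 (iii) pp.11-12] [claim: Mochizuki2012, status: disputed] -/
theorem exists_ringEquiv_fixedField_push_pull (U : CosetCat H) :
    ∃ e : ((CosetCat.push ι ho ⋙ cosetFixedSubext F).obj U).L ≃+*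
        ((CosetCat.push ι ho ⋙ cosetFixedSubext F).obj ((CosetCat.pull ψ hψc hψs).obj U)).L,
      ∀ a, (e a : Fbar F) = τ a := by
  refine ⟨{ toFun := fun a => ⟨τ a, apply_mem_fixedField_push_pull ι ho ψ hψc hψs τ hτ U a.2⟩
            invFun := fun b => ⟨τ.symm b, (mem_fixedField_push_pull_iff ι ho ψ hψc hψs τ hτ U b).1 b.2⟩
            left_inv := fun a => Subtype.ext (τ.symm_apply_apply (a : Fbar F))
            right_inv := fun b => Subtype.ext (τ.apply_symm_apply (b : Fbar F))
            map_mul' := fun a b => Subtype.ext (map_mul τ (a : Fbar F) b)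
            map_add' := fun a b => Subtype.ext (map_add τ (a : Fbar F) b) }, fun a => rfl⟩

include hτ hψs in
/-- **Naturality of `a ↦ τ a` for the arrows of the push carrier**: for `f : H/U → H/U′` with point `h₀·U′`, the push of `f` acts on
fields by `ι(h₀)` and the push of `ψ^* f` by `ι(h₁)` for any `h₁` with `ψ h₁ = h₀`; and `ι(h₁)(τ a) = τ(ι(h₀) a)`.
([IUTchI] Ex 5.1 (i) p.123) [cite: MochizukiFrdII2008, Ex 1.3 (iii) pp.11-12] [claim: Mochizuki2012, status: disputed] -/
theorem coe_cosetFixedSubext_push_pull_map {U U' : CosetCat H} (f : U ⟶ U')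
    (a : ((CosetCat.push ι ho ⋙ cosetFixedSubext F).obj U').L) :
    ((((CosetCat.push ι ho ⋙ cosetFixedSubext F).map ((CosetCat.pull ψ hψc hψs).map f)).toAlgHom
        ⟨τ a, apply_mem_fixedField_push_pull ι ho ψ hψc hψs τ hτ U' a.2⟩ :
        ((CosetCat.push ι ho ⋙ cosetFixedSubext F).obj ((CosetCat.pull ψ hψc hψs).obj U)).L) : Fbar F) =
      τ ((((CosetCat.push ι ho ⋙ cosetFixedSubext F).map f).toAlgHom a :
        ((CosetCat.push ι ho ⋙ cosetFixedSubext F).obj U).L) : Fbar F) := by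
  obtain ⟨h₀, hh₀⟩ := QuotientGroup.mk_surjective (CosetCat.pt f)
  obtain ⟨h₁, rfl⟩ := hψs h₀
  -- the point of the push of `f` is `ι(ψ h₁)·ι(U′)`, that of the push of `ψ^* f` is `ι(h₁)·ι(ψ⁻¹U′)`
  have hg : ((ι (ψ h₁) : GalFbar F) : ((CosetCat.push ι ho).obj U').carrier) = CosetCat.pt ((CosetCat.push ι ho).map f) := by
    rw [CosetCat.pt_push_map, ← hh₀, CosetCat.pushQuot_coe]
  have hpt : CosetCat.pt ((CosetCat.pull ψ hψc hψs).map f) =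
      ((h₁ : H) : ((CosetCat.pull ψ hψc hψs).obj U').carrier) := by
    rw [CosetCat.pt_pull_map, ← hh₀, Equiv.symm_apply_eq, CosetCat.pullEquiv_coe]
  have hg' : ((ι h₁ : GalFbar F) : ((CosetCat.push ι ho).obj ((CosetCat.pull ψ hψc hψs).obj U')).carrier) =
      CosetCat.pt ((CosetCat.push ι ho).map ((CosetCat.pull ψ hψc hψs).map f)) := by
    rw [CosetCat.pt_push_map, hpt, CosetCat.pushQuot_coe]
  change ((((cosetFixedSubext F).map ((CosetCat.push ι ho).map ((CosetCat.pull ψ hψc hψs).map f))).toAlgHom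
      ⟨τ a, _⟩ : ((cosetFixedSubext F).obj _).L) : Fbar F) =
    τ ((((cosetFixedSubext F).map ((CosetCat.push ι ho).map f)).toAlgHom a : ((cosetFixedSubext F).obj _).L) : Fbar F)
  rw [cosetFixedSubext_map_apply _ hg', cosetFixedSubext_map_apply _ hg]
  exact hτ h₁ a

end Twist

/-! ### §2. The natural family of ring isomorphisms along a twist `Θ ⋙ Φ ≅ Φ ⋙ ψ^*` read through `Φ : D ⥤ CosetCat H` -/

section Family

universe v₁ u₁

variable {F : Type} [Field F] [PerfectField F]
  {H : Type} [Group H] [TopologicalSpace H] (ι : H →* GalFbar F) (ho : IsOpenMap ι)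
  (ψ : H →* H) (hψc : Continuous ψ) (hψs : Surjective ψ)
  (τ : Fbar F ≃+* Fbar F) (hτ : ∀ (h : H) (x : Fbar F), ι h (τ x) = τ (ι (ψ h) x))
  {D : Type u₁} [Category.{v₁} D] (Φ : D ⥤ CosetCat H) (Θ : D ⥤ D)
  (ξ : Θ ⋙ Φ ≅ Φ ⋙ CosetCat.pull ψ hψc hψs)

include hτ hψc hψs ξ in
/-- **The natural family `ρ_A : F̄^{ι(U_{Φ A})} ≃+* F̄^{ι(U_{Φ (Θ A)})}`** along a twist `ξ : Θ ⋙ Φ ≅ Φ ⋙ ψ^*` of the base: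
`ρ_A := (push ⋙ Spec F̄^{(−)})(ξ_A) ∘ (a ↦ τ a)`, natural for the arrows of the push carrier read through `Φ` (twin of abc-iut-w4-d109's
`QuasiTemperoid.exists_ringEquiv_family_of_twist`, for a twist that need NOT come from an endomorphism of `G_F`).
([IUTchI] Ex 5.1 (i) p.123) [cite: MochizukiFrdII2008, Ex 1.3 (iii) pp.11-12] [claim: Mochizuki2012, status: disputed] -/
theorem exists_ringEquiv_family_of_push_twist :
    ∃ ρ : ∀ A : D, ((Φ ⋙ CosetCat.push ι ho ⋙ cosetFixedSubext F).obj A).L ≃+*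
        ((Φ ⋙ CosetCat.push ι ho ⋙ cosetFixedSubext F).obj (Θ.obj A)).L,
      ∀ ⦃A A' : D⦄ (f : A ⟶ A') (a : ((Φ ⋙ CosetCat.push ι ho ⋙ cosetFixedSubext F).obj A').L),
        ρ A (((Φ ⋙ CosetCat.push ι ho ⋙ cosetFixedSubext F).map f).toAlgHom a) =
          ((Φ ⋙ CosetCat.push ι ho ⋙ cosetFixedSubext F).map (Θ.map f)).toAlgHom (ρ A' a) := by
  let S₀ : CosetCat H ⥤ FinSubextCat F (Fbar F) := CosetCat.push ι ho ⋙ cosetFixedSubext F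
  let P : CosetCat H ⥤ CosetCat H := CosetCat.pull ψ hψc hψs
  have hji : ∀ A : D, (S₀.map (ξ.inv.app A)).toAlgHom.comp (S₀.map (ξ.hom.app A)).toAlgHom = AlgHom.id F _ := fun A => by
    have h := congrArg (fun k => (S₀.map k).toAlgHom) (ξ.inv_hom_id_app A)
    rw [S₀.map_comp, CategoryTheory.Functor.map_id] at h
    exact h
  have hij : ∀ A : D, (S₀.map (ξ.hom.app A)).toAlgHom.comp (S₀.map (ξ.inv.app A)).toAlgHom = AlgHom.id F _ := fun A => by
    have h := congrArg (fun k => (S₀.map k).toAlgHom) (ξ.hom_inv_id_app A)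
    rw [S₀.map_comp, CategoryTheory.Functor.map_id] at h
    exact h
  let j : ∀ A : D, (S₀.obj (P.obj (Φ.obj A))).L ≃ₐ[F] (S₀.obj (Φ.obj (Θ.obj A))).L := fun A =>
    AlgEquiv.ofAlgHom (S₀.map (ξ.hom.app A)).toAlgHom (S₀.map (ξ.inv.app A)).toAlgHom (hij A) (hji A)
  have hj : ∀ (A : D) b, j A b = (S₀.map (ξ.hom.app A)).toAlgHom b := fun A b => rfl
  choose e he using fun A : D => exists_ringEquiv_fixedField_push_pull ι ho ψ hψc hψs τ hτ (Φ.obj A)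
  have he' : ∀ (A : D) (a : (S₀.obj (Φ.obj A)).L),
      e A a = ⟨τ a, apply_mem_fixedField_push_pull ι ho ψ hψc hψs τ hτ (Φ.obj A) a.2⟩ :=
    fun A a => Subtype.ext (he A a)
  refine ⟨fun A => (e A).trans (j A).toRingEquiv, fun A A' f a => ?_⟩
  change j A (e A ((S₀.map (Φ.map f)).toAlgHom a)) = (S₀.map (Φ.map (Θ.map f))).toAlgHom (j A' (e A' a))
  rw [hj, hj, he', he']
  -- `τ (ι(h₀) a) = S₀(ψ^* (Φ f)) (τ a)`
  have h1 : (⟨τ ((S₀.map (Φ.map f)).toAlgHom a),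
        apply_mem_fixedField_push_pull ι ho ψ hψc hψs τ hτ (Φ.obj A) ((S₀.map (Φ.map f)).toAlgHom a).2⟩ :
        (S₀.obj (P.obj (Φ.obj A))).L) =
      (S₀.map (P.map (Φ.map f))).toAlgHom ⟨τ a, apply_mem_fixedField_push_pull ι ho ψ hψc hψs τ hτ (Φ.obj A') a.2⟩ :=
    Subtype.ext (coe_cosetFixedSubext_push_pull_map ι ho ψ hψc hψs τ hτ (Φ.map f) a).symm
  rw [h1]
  -- naturality of `ξ`: `Φ (Θ f) ≫ ξ_{A′} = ξ_A ≫ ψ^* (Φ f)`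
  have h2 : (Θ ⋙ Φ).map f ≫ ξ.hom.app A' = ξ.hom.app A ≫ (Φ ⋙ P).map f := ξ.hom.naturality f
  change ((S₀.map (ξ.hom.app A) ≫ S₀.map (P.map (Φ.map f))).toAlgHom) _ =
    ((S₀.map (Φ.map (Θ.map f)) ≫ S₀.map (ξ.hom.app A')).toAlgHom) _
  rw [← Functor.map_comp, ← Functor.map_comp]
  exact congrArg (fun k => (S₀.map k).toAlgHom ⟨τ a, apply_mem_fixedField_push_pull ι ho ψ hψc hψs τ hτ (Φ.obj A') a.2⟩)
    h2.symm

omit [PerfectField F] in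
/-- **Transport of a natural family of ring isomorphisms along an isomorphism of base functors** `jS : S ≅ S′` into `FinSubextCat F K`:
a family natural for `S′` over `Θ` yields one for `S` (conjugate by the `F`-algebra isomorphisms `jS_A`). ([IUTchI] Ex 5.1 (iii) p.125)
[cite: MochizukiFrdI2008, Ex. 6.3 p.113] [claim: Mochizuki2012, status: disputed] -/
theorem exists_ringEquiv_family_of_iso {K : Type} [Field K] [Algebra F K] (S S' : D ⥤ FinSubextCat F K) (jS : S ≅ S')
    (ρ' : ∀ A : D, (S'.obj A).L ≃+* (S'.obj (Θ.obj A)).L)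
    (hρ' : ∀ ⦃A A' : D⦄ (f : A ⟶ A') (a : (S'.obj A').L),
      ρ' A ((S'.map f).toAlgHom a) = (S'.map (Θ.map f)).toAlgHom (ρ' A' a)) :
    ∃ ρ : ∀ A : D, (S.obj A).L ≃+* (S.obj (Θ.obj A)).L,
      ∀ ⦃A A' : D⦄ (f : A ⟶ A') (a : (S.obj A').L),
        ρ A ((S.map f).toAlgHom a) = (S.map (Θ.map f)).toAlgHom (ρ A' a) := by
  have h1 : ∀ A : D, (jS.inv.app A).toAlgHom.comp (jS.hom.app A).toAlgHom = AlgHom.id F _ := fun A =>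
    congrArg FinSubextCat.Hom.toAlgHom (jS.inv_hom_id_app A)
  have h2 : ∀ A : D, (jS.hom.app A).toAlgHom.comp (jS.inv.app A).toAlgHom = AlgHom.id F _ := fun A =>
    congrArg FinSubextCat.Hom.toAlgHom (jS.hom_inv_id_app A)
  let k : ∀ A : D, (S'.obj A).L ≃ₐ[F] (S.obj A).L := fun A =>
    AlgEquiv.ofAlgHom (jS.hom.app A).toAlgHom (jS.inv.app A).toAlgHom (h2 A) (h1 A)
  have hk : ∀ (A : D) b, k A b = (jS.hom.app A).toAlgHom b := fun A b => rfl
  have hk' : ∀ (A : D) b, (k A).symm b = (jS.inv.app A).toAlgHom b := fun A b => rfl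
  refine ⟨fun A => ((k A).symm.toRingEquiv.trans (ρ' A)).trans (k (Θ.obj A)).toRingEquiv, fun A A' f a => ?_⟩
  change k (Θ.obj A) (ρ' A ((k A).symm ((S.map f).toAlgHom a))) =
    (S.map (Θ.map f)).toAlgHom (k (Θ.obj A') (ρ' A' ((k A').symm a)))
  rw [hk, hk, hk', hk']
  -- naturality of `jS.inv` at `f` and of `jS.hom` at `Θ f`, on elements
  have n1 : (jS.inv.app A).toAlgHom ((S.map f).toAlgHom a) = (S'.map f).toAlgHom ((jS.inv.app A').toAlgHom a) :=
    congrArg (fun t => FinSubextCat.Hom.toAlgHom t a) (jS.inv.naturality f).symm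
  have n2 : ∀ c, (jS.hom.app (Θ.obj A)).toAlgHom ((S'.map (Θ.map f)).toAlgHom c) =
      (S.map (Θ.map f)).toAlgHom ((jS.hom.app (Θ.obj A')).toAlgHom c) := fun c =>
    congrArg (fun t => FinSubextCat.Hom.toAlgHom t c) (jS.hom.naturality (Θ.map f)).symm
  rw [n1, hρ', n2]

end Family

end PushCarrier

/-! ### §3. `hlift⊚` at EVERY open-embedding push carrier modulo Neukirch–Uchida BY NAME — no normality, no descent law -/

namespace GlobalFrobenioid

variable (F : Type) [Field F] [NumberField F]

/-- **[IUTchI] Cor 5.3 (i) «respectively `⊚`», SURJECTIVITY half at the push carrier of EVERY OPEN EMBEDDING `ι : H ↪ G_F`**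
(`H` profinite; `ι` continuous, open, injective — the class of print's `π₁(†𝒟^⊚) ↪ π₁(†𝒟^⊛)`, Ex 5.1 (i)), for EVERY record `𝓕`:
under every self-equivalence `Θ` of `†𝒟^⊚ = ℬ(H)⁰` lies a self-equivalence of `†ℱ^⊚` — the (k2) binder `hlift` of abc-iut-L5-t4's
★ `Cor53.fcirc_descendBijective_of_kernel_trivial_of_lifts` (`Cor53TelescopeCensusKnit.lean` l.151–152: `(hlift : ∀ Θ : BaseCat H ≌
BaseCat H, ∃ Ψ : 𝓕.Fcirc ≌ 𝓕.Fcirc, Nonempty (CatIsomorphism.LiesUnder 𝓕.fcircBase 𝓕.fcircBase Ψ Θ))`) VERBATIM — modulo FACT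
{`NeukirchUchida F`} ONLY: NO `Normal ℚ F`, NO
`AutCompatible ι`, NO descent `hdesc⊚` of `Θ` to `ℬ(G_F)⁰`.  ROUTE (direct, not through `†ℱ^⊛`): `Θ` is restriction along `φ⁻¹` for a
topological automorphism `φ` of `H` ([SemiAnbd] Prop 3.2 on the small coset model, `H` Galois-countable); Neukirch–Uchida AS TYPED at
`U₁ = U₂ = ι(H)` gives a field automorphism `τ` of `F̄` with `ι(φ h) ∘ τ = τ ∘ ι(h)` — `τ` normalises `ι(H)`, NOT necessarily `G_F`;
`a ↦ τ a` carries `F̄^{ι(U)}` onto `F̄^{ι(φ U)}` naturally for the arrows of the push carrier (§1–§2), so [FrdI] Ex 6.3's functoriality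
in ring isomorphisms (abc-iut-w4-d109's ★ `ArithDivisorData.exists_equivalence_over_of_ringEquiv`) yields a self-equivalence of the
model Frobenioid of the WHISKERED arithmetic data `(Φ^⊛ ∘ T, 𝔹^⊛ ∘ T, Div ∘ T)` over `Θ` ON THE NOSE, and `†ℱ^⊚ ≌` that model over
`ℬ(H)⁰` ([FrdI] §0 + Prop 1.6 bricks ★ `exists_fcirc_equivalence_fiberProduct_over` / ★ `ModelFrobenioid.exists_fiberProduct_equivalence`,
§0 transport).  OUR carrier and OUR lift route (print's surjectivity is functorial reconstruction, Ex 5.1 (v)); a named fact held as a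
hypothesis is bookkeeping. ([IUTchI] Cor 5.3 (i) p.144) [cite: NeukirchSchmidtWingberg2008, Thm (12.2.1)]
[cite: MochizukiFrdI2008, Ex. 6.3 p.113] [claim: Mochizuki2012, status: disputed] -/
theorem liftsAll_fcircBase_arith_of_openEmbedding_of_neukirchUchida (hNU : NeukirchUchida F)
    (H : ProfiniteGrp.{0}) (ι : H →* GalFbar F) (hc : Continuous ι) (ho : IsOpenMap ι) (hinj : Injective ι)
    (𝓕 : GlobalFrobenioid (GlobalDivisorData.arith F) (BaseCat H)
      (baseToCoset H ⋙ CosetCat.push ι ho ⋙ cosetToBase (absGalGrp F))) :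
    ∀ Θ : BaseCat H ≌ BaseCat H, ∃ Ψ : 𝓕.Fcirc ≌ 𝓕.Fcirc,
      Nonempty (CatIsomorphism.LiesUnder 𝓕.fcircBase 𝓕.fcircBase Ψ Θ) := by
  intro Θ
  haveI : IsGalois F (Fbar F) := isGalois_fbar F
  haveI : SecondCountableTopology H := secondCountableTopology_of_openEmbedding F H ι hc hinj
  haveI := BCat.connectedToBTemp_isEquivalence H
  haveI := BCat.connectedToBTemp_isEquivalence (absGalGrp F)
  have hTH : IsTempered H := IsTempered.of_profinite
  have hT : IsTempered (GalFbar F) := IsTempered.of_profinite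
  -- (1) `†ℱ^⊚ ≌` the whiskered model over `ℬ(H)⁰` along `T := baseMor ⋙ identify` ([FrdI] §0, Prop 1.6); by §0 lift `Θ` there
  obtain ⟨Q, hQ⟩ := 𝓕.exists_fcirc_equivalence_fiberProduct_over
  obtain ⟨E, hE, -⟩ := ModelFrobenioid.exists_fiberProduct_equivalence (GlobalDivisorData.arith F).Φ
    (GlobalDivisorData.arith F).B (GlobalDivisorData.arith F).div (𝓕.baseMor ⋙ 𝓕.identify.functor)
  refine CatIsomorphism.exists_lift_of_equivalence_over Q (eqToIso hQ)
    (CatIsomorphism.exists_lift_of_equivalence_over E (eqToIso hE) ?_)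
  -- (2) the bridge `Bα := α₁ ⋙ (ℬ(H)⁰ ⥲ CosetCat H)` and the conjugate self-equivalence `Ξ` of `CosetCat H`
  haveI : (baseToCoset H).IsEquivalence := Functor.isEquivalence_trans _ _
  let Bα : BaseCat H ≌ CosetCat H := 𝓕.α₁.trans (baseToCoset H).asEquivalence
  let Ξ : CosetCat H ≌ CosetCat H := Bα.symm.trans (Θ.trans Bα)
  have ξ₀ : Θ.functor ⋙ Bα.functor ≅ Bα.functor ⋙ Ξ.functor :=
    (Functor.leftUnitor _).symm ≪≫ Functor.isoWhiskerRight Bα.unitIso (Θ.functor ⋙ Bα.functor) ≪≫ Functor.associator _ _ _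
  -- (3) [SemiAnbd] Prop 3.2 on the coset model: `Ξ ≅ (φ⁻¹)^*`, `φ : H ≃ₜ* H` topological
  obtain ⟨φ, hφc, hφs, ⟨k⟩⟩ := CosetCat.exists_continuousMulEquiv_nonempty_iso_pull hTH hTH Ξ
  have ξ : Θ.functor ⋙ Bα.functor ≅ Bα.functor ⋙ CosetCat.pull φ.symm.toMonoidHom hφc hφs :=
    ξ₀ ≪≫ Functor.isoWhiskerLeft Bα.functor k
  -- (4) Neukirch–Uchida AS TYPED at `U₁ = U₂ = ι(H)`: `τ` with `ι(φ h) ∘ τ = τ ∘ ι(h)` — no normality of `F/ℚ` anywhere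
  obtain ⟨τ, hτ⟩ := exists_ringEquiv_inducing_of_neukirchUchida F H ι hc ho hinj hNU φ
  have hτ' : ∀ (h : H) (x : Fbar F), ι h (τ x) = τ (ι (φ.symm.toMonoidHom h) x) := fun h x => by
    have h1 := hτ (φ.symm h) x; rwa [ContinuousMulEquiv.apply_symm_apply] at h1
  -- (5) the natural family `a ↦ τ a` for `Bα ⋙ push ι ⋙ Spec F̄^{(−)}`, transported to `S := T ⋙ galoisSubextOfFinite F`:
  obtain ⟨ρ', hρ'⟩ := PushCarrier.exists_ringEquiv_family_of_push_twist ι ho φ.symm.toMonoidHom hφc hφs τ hτ' Bα.functor Θ.functor ξ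
  obtain ⟨e₂⟩ := nonempty_toConnected_galoisSubext_iso_cosetFixedSubext F hT
  have jS : (𝓕.baseMor ⋙ 𝓕.identify.functor) ⋙ galoisSubextOfFinite F ≅
      Bα.functor ⋙ CosetCat.push ι ho ⋙ cosetFixedSubext F := by
    refine Functor.isoWhiskerRight 𝓕.compat.symm (galoisSubextOfFinite F) ≪≫ ?_
    refine (Functor.isoWhiskerLeft (Bα.functor ⋙ CosetCat.push ι ho ⋙ CosetCat.toConnected hT)
      (Functor.isoWhiskerRight (BCat.connectedToBTemp (absGalGrp F)).asEquivalence.counitIso (galoisSubext F)) :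
        (Bα.functor ⋙ CosetCat.push ι ho ⋙ CosetCat.toConnected hT) ⋙
            ((BCat.connectedToBTemp (absGalGrp F)).inv ⋙ BCat.connectedToBTemp (absGalGrp F)) ⋙ galoisSubext F ≅
          (Bα.functor ⋙ CosetCat.push ι ho ⋙ CosetCat.toConnected hT) ⋙ 𝟭 _ ⋙ galoisSubext F) ≪≫ ?_
    exact Functor.isoWhiskerLeft (Bα.functor ⋙ CosetCat.push ι ho) e₂
  obtain ⟨ρ, hρ⟩ := PushCarrier.exists_ringEquiv_family_of_iso Θ.functor _ _ jS ρ' hρ'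
  -- (6) [FrdI] Ex 6.3 is functorial in ring isomorphisms: a self-equivalence of the whiskered model over `Θ` ON THE NOSE
  obtain ⟨Ψ, hΨ, -⟩ := ArithDivisorData.exists_equivalence_over_of_ringEquiv
    ((𝓕.baseMor ⋙ 𝓕.identify.functor) ⋙ galoisSubextOfFinite F)
    ((𝓕.baseMor ⋙ 𝓕.identify.functor) ⋙ galoisSubextOfFinite F) Θ.functor ρ hρ
  exact ⟨Ψ, ⟨eqToIso hΨ⟩⟩

end GlobalFrobenioid

/-! ### §4. KNIT — [IUTchI] Cor 5.3 (i) «resp. ⊚» AS PRINTED at EVERY open-embedding carrier: LAW ∅ · FACT {NU} · SIDE ∅ -/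

namespace Cor53

variable (F : Type) [Field F] [NumberField F]

/-- **[IUTchI] Cor 5.3 (i) «resp. `⊚`» AS PRINTED («bijective») at the push carrier of EVERY OPEN EMBEDDING `ι : H ↪ G_F`, for EVERY
record `𝓕`, SIDE-FREE**: the §0 natural map `Aut(†ℱ^⊚) → Aut(†𝒟^⊚)` is BIJECTIVE modulo FACT {`NeukirchUchida F`} BY NAME and NOTHING
ELSE — the statement of abc-iut-L5-t4's ★ `Cor53.fcirc_descendBijective_of_openEmbedding_of_neukirchUchida` with the SIDE hypothesis
`[Normal ℚ F]` DELETED.  Injectivity = ★ `Cor53.fcirc_rigidOverBase_of_pushCarrier` (`hZ` only, `hZ` ⟸ slimness of `G_F`);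
surjectivity = §3.  So `Normal ℚ F` was a hypothesis of the DESCENT ROUTE (`hdesc⊚ ⟺ AutCompatible ι`, abc-iut-L5-t4), not of
the printed claim at this carrier (the record type is INHABITED: abc-iut-w4-d050's ★ `nonempty_globalFrobenioid`).  OUR carrier and
OUR routes; typed ≠ proved for print. ([IUTchI] Cor 5.3 (i) p.144)
[cite: NeukirchSchmidtWingberg2008, Thm (12.2.1)] [cite: MochizukiFrdI2008, Prop. 1.6 p.27] [claim: Mochizuki2012, status: disputed] -/
theorem fcirc_descendBijective_of_openEmbedding_of_neukirchUchida_sideFree (hNU : NeukirchUchida F)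
    (H : ProfiniteGrp.{0}) (ι : H →* GalFbar F) (hc : Continuous ι) (ho : IsOpenMap ι) (hinj : Injective ι)
    (𝓕 : GlobalFrobenioid (GlobalDivisorData.arith F) (BaseCat H)
      (baseToCoset H ⋙ CosetCat.push ι ho ⋙ cosetToBase (absGalGrp F))) :
    CatIsomorphism.DescendBijective 𝓕.fcircBase 𝓕.fcircBase
      (GlobalFrobenioid.hasUnder_and_underUnique_fcircBase_arith_baseCat 𝓕 𝓕
        (isSlimGroup_of_injective_of_isOpenMap ι ho hinj (isSlimGroup_absGalGrp F))
        (isSlimGroup_of_injective_of_isOpenMap ι ho hinj (isSlimGroup_absGalGrp F))).1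
      (GlobalFrobenioid.hasUnder_and_underUnique_fcircBase_arith_baseCat 𝓕 𝓕
        (isSlimGroup_of_injective_of_isOpenMap ι ho hinj (isSlimGroup_absGalGrp F))
        (isSlimGroup_of_injective_of_isOpenMap ι ho hinj (isSlimGroup_absGalGrp F))).2 :=
  fcirc_descendBijective_of_kernel_trivial_of_lifts 𝓕
    (isSlimGroup_of_injective_of_isOpenMap ι ho hinj (isSlimGroup_absGalGrp F))
    (Cor53.fcirc_rigidOverBase_of_pushCarrier F H ι hc ho
      (isSlimGroup_of_injective_of_isOpenMap ι ho hinj (isSlimGroup_absGalGrp F)) 𝓕)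
    (GlobalFrobenioid.liftsAll_fcircBase_arith_of_openEmbedding_of_neukirchUchida F hNU H ι hc ho hinj 𝓕)

end Cor53

end Literature.IUT.HodgeTheaters

end
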